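import Literature.MathematicalPhysics.QuantumFieldTheory.BalabanImbrieJaffe1984to88.BIJ88WalkItinerary307
import Mathlib.Analysis.SpecialFunctions.Exp

/-!
# `BalabanImbrieJaffe1984to88.BIJ88TrainGeometryLetters309` — T. Bałaban, J. Imbrie, A. Jaffe, *Effective action and cluster properties of the
abelian Higgs model*, Commun. Math. Phys. **114** (1988) 257–315 [BalabanImbrieJaffe1988]: p. 307 [PDF 51] L11–18 (Sect. 5.13), verbatim:
*"Altogether we have small factors at each end of C_ω(α) … If the walk ω(α) wanders through more than a few cubes, we begin to pickup factors
e^{−cr(e_k)}. These control the sum over walks and partitions, and the factorials, as in [9]"* ([9] = Glimm–Jaffe–Spencer, Part II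
[GlimmJaffeSpencer1973], §8 (8.2): the distances `d(j,γ)` from the legs to the lines, measured in units of the lattice spacing of the cover) —
**THE GEOMETRIC LETTERS OF THE SIZE-FREE ROAD: FROM THE SITE METRIC AND THE CUBE METRIC TO THE END-STRETCH HYPOTHESES OF
`BIJ88TrainGainAssembly309`**.

Sites `α` in cubes `blk : α → I`, a site metric `d` and a cube metric `cd` tied by the scale letter `r·cd(blk x, blk y) − r₀ ≤ d(x,y)` (`r` = the
side of the cubes in lattice units, print's `r(e_k)`), a block distance `cdB(i,b) ≤ cd(i,i′)` for `i′ ∈ b`; the supports `S_b` of the boundary terms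
lie within site distance `1` of the cubes of `b` (band of `Δ`).  Then:
* §1 `le_sdist_singleton_left/right` — the entry/exit stretches `Dist({x},S_b)`, `Dist(S_b,{y})` are at least `r·cdB(blk ·, b) − (r₀+1)`;
  `exp_neg_sdist_le_exp_neg_max` — hence `e^{−μDist} ≤ e^{−μ·max(r·cdB − (r₀+1), 0)}` (the hypothesis `hUδ` of `BIJ88TrainGainAssembly309`);
* §2 `card_support_le` — `|S_b| ≤ |b|·z_c·(z+1)` (sites per cube `z_c`, local volume `z`); `sum_exp_neg_sdist_mul_le` — the source letter
  `Σ_y e^{−μDist(S_b,{y})}F_y ≤ F₀·|S_b|·Z` (`hUF`);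
* §3 `sum_slots_exp_le` — the slot lattice sum `Σ_{τ located} e^{−κ·max(r·min(cdB(cube τ,b₁),cdB(cube τ,b₂)) − r₀′,0)} ≤ s₀·2·|b|·Z_c`-type bound (`hZs`).

statement-level skeleton of published theorems with citation tags; proofs where landed; nothing here is a claim about the Yang–Mills mass gap

PDF held: `paper:balaban1988-cmp114-bij-abelian-higgs-effective-action` p. 307 (p0051 L11–18); [9] reprint p0233–p0234 — re-read this session.

CITATION HEADER (lean-in-tree rule).  Part of the lit-balaban TYPED SKELETON (HOME `run/shared/lean/pub/lit-balaban/`), Phase 2, seat p36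
(gen 23, unit `lit-balaban-p36`); rows **C2.Eq5.14.3-5.14.4** (member: size-free road, plumbing D2 of HOME `lit-balaban-p36/ASSEMBLY-PLAN.md`) and
C2.Eq5.13.3-5.13.4 (member) of `HOME/lit-balaban-r16/ROWS-C2-part2.md` (owner r16, referee ref-5).  Theorem-only; no definitions, no `Prop` facts;
axioms standard.  HONEST SCOPE: elementary metric bookkeeping under letters (the block distance, the supports and the slot-to-cube map are abstract
functions with their characterizing hypotheses); the identification with the model is the assembly file's.  NOT summit progress; NOT continuum; NOT Clay.
-/

namespace Literature.MathematicalPhysics.QuantumFieldTheory.BalabanImbrieJaffe1984to88.BIJ88TrainGeometryLetters309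

open Finset
open scoped BigOperators
open BIJ88WalkItinerary307 (sdist sdist_le le_sdist exists_sdist_eq sdist_nonneg)

variable {α I : Type} (blk : α → I) (d : α → α → ℝ) (cd : I → I → ℝ)

/-! ## §1  The end stretches against the cube metric -/

/-- **THE ENTRY STRETCH**: if every site of `S` is within site distance `1` of a site of a cube of `b`, `S ≠ ∅`, `d` is a pseudometric,
`r·cd(blk x, blk y) − r₀ ≤ d(x,y)` (`r ≥ 0`) and `cdB ≤ cd(blk x, i′)` for the cubes `i′ ∈ b`, then `r·cdB − (r₀+1) ≤ Dist({x}, S)`.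
[cite: BalabanImbrieJaffe1988, §5.13 p.307 L11–16] [cite: GlimmJaffeSpencer1973, §8 (8.2) p0233] -/
theorem le_sdist_singleton_left (hdtri : ∀ x y w, d x w ≤ d x y + d y w) {r r₀ : ℝ} (hr : 0 ≤ r)
    (hgeo : ∀ x y, r * cd (blk x) (blk y) - r₀ ≤ d x y) (b : Finset I) (S : Finset α) (hS : S.Nonempty)
    (hSb : ∀ y ∈ S, ∃ y', blk y' ∈ b ∧ d y y' ≤ 1) (x : α) {cdB : ℝ} (hcdB : ∀ i' ∈ b, cdB ≤ cd (blk x) i') :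
    r * cdB - (r₀ + 1) ≤ sdist d {x} S := by
  refine le_sdist d (singleton_nonempty x) hS fun a ha y hy => ?_
  rw [mem_singleton.1 ha]
  obtain ⟨y', hy'b, hyy'⟩ := hSb y hy
  have h1 := hgeo x y'
  have h2 := hdtri x y y'
  have h3 := mul_le_mul_of_nonneg_left (hcdB _ hy'b) hr
  linarith

/-- **THE EXIT STRETCH**: symmetrically `r·cdB − (r₀+1) ≤ Dist(S, {y})`. [cite: BalabanImbrieJaffe1988, §5.13 p.307 L11–16]
[cite: GlimmJaffeSpencer1973, §8 (8.2) p0233] -/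
theorem le_sdist_singleton_right (hdsymm : ∀ x y, d x y = d y x) (hdtri : ∀ x y w, d x w ≤ d x y + d y w) {r r₀ : ℝ} (hr : 0 ≤ r)
    (hgeo : ∀ x y, r * cd (blk x) (blk y) - r₀ ≤ d x y) (b : Finset I) (S : Finset α) (hS : S.Nonempty)
    (hSb : ∀ y ∈ S, ∃ y', blk y' ∈ b ∧ d y y' ≤ 1) (y : α) {cdB : ℝ} (hcdB : ∀ i' ∈ b, cdB ≤ cd (blk y) i') :
    r * cdB - (r₀ + 1) ≤ sdist d S {y} := by
  refine le_sdist d hS (singleton_nonempty y) fun a ha w hw => ?_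
  rw [mem_singleton.1 hw, hdsymm]
  obtain ⟨y', hy'b, hyy'⟩ := hSb a ha
  have h1 := hgeo y y'
  have h2 := hdtri y a y'
  have h3 := mul_le_mul_of_nonneg_left (hcdB _ hy'b) hr
  linarith

/-- monotone form: `t ≤ D`, `0 ≤ D` ⇒ `e^{−μD} ≤ e^{−μ·max(t,0)}` (`μ ≥ 0`) — the shape of the hypotheses `hUδ`, `hU′δ` of
`BIJ88TrainGainAssembly309`. [cite: BalabanImbrieJaffe1988, §5.13 p.307 L11–16] -/
theorem exp_neg_le_exp_neg_max {μ t D : ℝ} (hμ : 0 ≤ μ) (htD : t ≤ D) (hD : 0 ≤ D) :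
    Real.exp (-(μ * D)) ≤ Real.exp (-(μ * max t 0)) :=
  Real.exp_le_exp.2 (neg_le_neg (mul_le_mul_of_nonneg_left (max_le htD hD) hμ))

/-- **`hUδ` FROM THE LETTERS**: `e^{−μ·Dist({x},S_b)} ≤ e^{−μ·max(r·cdB − (r₀+1), 0)}` (`d ≥ 0`). [cite: BalabanImbrieJaffe1988, §5.13 p.307 L11–16] -/
theorem exp_neg_sdist_singleton_left_le (hd0 : ∀ x y, 0 ≤ d x y)
    (hdtri : ∀ x y w, d x w ≤ d x y + d y w) {r r₀ μ : ℝ} (hr : 0 ≤ r) (hμ : 0 ≤ μ)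
    (hgeo : ∀ x y, r * cd (blk x) (blk y) - r₀ ≤ d x y) (b : Finset I) (S : Finset α) (hS : S.Nonempty)
    (hSb : ∀ y ∈ S, ∃ y', blk y' ∈ b ∧ d y y' ≤ 1) (x : α) {cdB : ℝ} (hcdB : ∀ i' ∈ b, cdB ≤ cd (blk x) i') :
    Real.exp (-(μ * sdist d {x} S)) ≤ Real.exp (-(μ * max (r * cdB - (r₀ + 1)) 0)) :=
  exp_neg_le_exp_neg_max hμ (le_sdist_singleton_left blk d cd hdtri hr hgeo b S hS hSb x hcdB) (sdist_nonneg d hd0 _ _)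

/-- **`hU′δ` FROM THE LETTERS**: `e^{−μ·Dist(S_b,{y})} ≤ e^{−μ·max(r·cdB − (r₀+1), 0)}`. [cite: BalabanImbrieJaffe1988, §5.13 p.307 L11–16] -/
theorem exp_neg_sdist_singleton_right_le (hd0 : ∀ x y, 0 ≤ d x y) (hdsymm : ∀ x y, d x y = d y x)
    (hdtri : ∀ x y w, d x w ≤ d x y + d y w) {r r₀ μ : ℝ} (hr : 0 ≤ r) (hμ : 0 ≤ μ)
    (hgeo : ∀ x y, r * cd (blk x) (blk y) - r₀ ≤ d x y) (b : Finset I) (S : Finset α) (hS : S.Nonempty)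
    (hSb : ∀ y ∈ S, ∃ y', blk y' ∈ b ∧ d y y' ≤ 1) (y : α) {cdB : ℝ} (hcdB : ∀ i' ∈ b, cdB ≤ cd (blk y) i') :
    Real.exp (-(μ * sdist d S {y})) ≤ Real.exp (-(μ * max (r * cdB - (r₀ + 1)) 0)) :=
  exp_neg_le_exp_neg_max hμ (le_sdist_singleton_right blk d cd hdsymm hdtri hr hgeo b S hS hSb y hcdB) (sdist_nonneg d hd0 _ _)

/-! ## §2  The supports and the source letter -/

/-- `e^{−μ·Dist(S,{y})} ≤ Σ_{y′∈S} e^{−μ d(y′,y)}` for `S ≠ ∅` (the set distance is attained). [cite: GlimmJaffeSpencer1973, §8 (8.2) p0233] -/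
theorem exp_neg_sdist_le_sum (S : Finset α) (hS : S.Nonempty) (y : α) (μ : ℝ) :
    Real.exp (-(μ * sdist d S {y})) ≤ ∑ y' ∈ S, Real.exp (-(μ * d y' y)) := by
  obtain ⟨a, ha, w, hw, h⟩ := exists_sdist_eq d hS (singleton_nonempty y)
  rw [mem_singleton.1 hw] at h
  rw [h]
  exact single_le_sum (f := fun y' => Real.exp (-(μ * d y' y))) (fun y' _ => (Real.exp_pos _).le) ha

section Support

variable [Fintype α] [DecidableEq α] [DecidableEq I]

/-- **THE SUPPORT OF A BOUNDARY TERM IS SMALL**: if every site of `S` is within site distance `1` of a site of a cube of `b`, at most `z_c` sites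
per cube and at most `z + 1` sites within distance `1` of any site, then `|S| ≤ |b|·z_c·(z+1)`. [cite: BalabanImbrieJaffe1988, §5.13 p.305–307] -/
theorem card_support_le (b : Finset I) (S : Finset α) (hSb : ∀ y ∈ S, ∃ y', blk y' ∈ b ∧ d y y' ≤ 1) {zc z1 : ℝ}
    (hz10 : 0 ≤ z1) (hzc : ∀ i, ((univ.filter fun x : α => blk x = i).card : ℝ) ≤ zc)
    (hz1 : ∀ y' : α, ((univ.filter fun y : α => d y y' ≤ 1).card : ℝ) ≤ z1) :
    (S.card : ℝ) ≤ b.card * (zc * z1) := by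
  classical
  have hsub : S ⊆ b.biUnion (fun i' => (univ.filter fun y' : α => blk y' = i').biUnion
      fun y' => univ.filter fun y : α => d y y' ≤ 1) := by
    intro y hy
    obtain ⟨y', hb, hd⟩ := hSb y hy
    simp only [mem_biUnion, mem_filter, mem_univ, true_and]
    exact ⟨blk y', hb, y', rfl, hd⟩
  have h1 : S.card ≤ ∑ i' ∈ b, ∑ y' ∈ univ.filter (fun y' : α => blk y' = i'), (univ.filter fun y : α => d y y' ≤ 1).card :=
    (card_le_card hsub).trans (card_biUnion_le.trans (sum_le_sum fun i' _ => card_biUnion_le))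
  calc (S.card : ℝ) ≤ ∑ i' ∈ b, ∑ y' ∈ univ.filter (fun y' : α => blk y' = i'), ((univ.filter fun y : α => d y y' ≤ 1).card : ℝ) := by
        exact_mod_cast h1
    _ ≤ ∑ i' ∈ b, ∑ _y' ∈ univ.filter (fun y' : α => blk y' = i'), z1 := sum_le_sum fun i' _ => sum_le_sum fun y' _ => hz1 y'
    _ = ∑ i' ∈ b, ((univ.filter fun y' : α => blk y' = i').card : ℝ) * z1 := by simp only [sum_const, nsmul_eq_mul]
    _ ≤ ∑ _i' ∈ b, zc * z1 := sum_le_sum fun i' _ => mul_le_mul_of_nonneg_right (hzc i') hz10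
    _ = b.card * (zc * z1) := by rw [sum_const, nsmul_eq_mul]

omit [DecidableEq α] in
/-- **THE SOURCE LETTER `hUF`**: with the sitewise letter `0 ≤ F_y ≤ F₀` and the site lattice sum `Σ_y e^{−μd(y′,y)} ≤ Z`,
`Σ_y e^{−μ·Dist(S,{y})}·F_y ≤ F₀·|S|·Z` (`S ≠ ∅`; p. 307: *"factors ℱ = O(e^{−cr(e_k)})"* at the source end of a train).
[cite: BalabanImbrieJaffe1988, §5.13 p.307 L2–4, L11–16] -/
theorem sum_exp_neg_sdist_mul_le (S : Finset α) (hS : S.Nonempty) {μ F₀ Z : ℝ} (F : α → ℝ) (hF0 : ∀ y, 0 ≤ F y)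
    (hF : ∀ y, F y ≤ F₀) (hZ : ∀ y' : α, ∑ y : α, Real.exp (-(μ * d y' y)) ≤ Z) :
    ∑ y : α, Real.exp (-(μ * sdist d S {y})) * F y ≤ F₀ * (S.card * Z) := by
  have hF₀ : 0 ≤ F₀ := (hF0 (Classical.choice (let ⟨a, _⟩ := hS; ⟨a⟩))).trans (hF _)
  calc ∑ y : α, Real.exp (-(μ * sdist d S {y})) * F y
      ≤ ∑ y : α, (∑ y' ∈ S, Real.exp (-(μ * d y' y))) * F₀ :=
        sum_le_sum fun y _ => mul_le_mul (exp_neg_sdist_le_sum d S hS y μ) (hF y) (hF0 y)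
          (sum_nonneg fun y' _ => (Real.exp_pos _).le)
    _ = F₀ * ∑ y' ∈ S, ∑ y : α, Real.exp (-(μ * d y' y)) := by rw [← sum_mul, mul_comm, sum_comm]
    _ ≤ F₀ * ∑ _y' ∈ S, Z := mul_le_mul_of_nonneg_left (sum_le_sum fun y' _ => hZ y') hF₀
    _ = F₀ * (S.card * Z) := by rw [sum_const, nsmul_eq_mul]

end Support

/-! ## §3  Block distances on the cube lattice; the slot lattice sum -/

section Cubes

/-- **SUPPORTS OF NON-TOUCHING BLOCKS ARE FAR**: `r·Dist_cd(b,u) − (r₀+2) ≤ Dist_d(S_b,S_u)` when the supports lie within site distance `1` of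
their blocks' cubes (`S_b, S_u ≠ ∅`). [cite: BalabanImbrieJaffe1988, §5.13 p.307 L11–16] [cite: GlimmJaffeSpencer1973, §8 (8.8) p0234] -/
theorem le_sdist_supports (hdsymm : ∀ x y, d x y = d y x) (hdtri : ∀ x y w, d x w ≤ d x y + d y w) {r r₀ : ℝ} (hr : 0 ≤ r)
    (hgeo : ∀ x y, r * cd (blk x) (blk y) - r₀ ≤ d x y) (b u : Finset I) (Sb Su : Finset α) (hSb0 : Sb.Nonempty)
    (hSu0 : Su.Nonempty) (hSb : ∀ y ∈ Sb, ∃ y', blk y' ∈ b ∧ d y y' ≤ 1) (hSu : ∀ y ∈ Su, ∃ y', blk y' ∈ u ∧ d y y' ≤ 1) :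
    r * sdist cd b u - (r₀ + 2) ≤ sdist d Sb Su := by
  refine le_sdist d hSb0 hSu0 fun y hy w hw => ?_
  obtain ⟨y1, hy1b, h1⟩ := hSb y hy
  obtain ⟨w1, hw1u, h2⟩ := hSu w hw
  have h3 := hgeo y1 w1
  have h4 : sdist cd b u ≤ cd (blk y1) (blk w1) := sdist_le cd hy1b hw1u
  have h5 := hdtri y1 y w1
  have h6 := hdtri y w w1
  rw [hdsymm y1 y] at h5
  nlinarith

/-- the block distance from a cube is attained: `e^{−κ·max(r·Dist_cd({i},b) − r₀, 0)} ≤ Σ_{i′∈b} e^{−κ·max(r·cd(i,i′) − r₀, 0)}` (`b ≠ ∅`).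
[cite: GlimmJaffeSpencer1973, §8 (8.2) p0233] -/
theorem exp_neg_max_sdist_singleton_le_sum (b : Finset I) (hb : b.Nonempty) (i : I) (κ r r₀ : ℝ) :
    Real.exp (-(κ * max (r * sdist cd {i} b - r₀) 0)) ≤ ∑ i' ∈ b, Real.exp (-(κ * max (r * cd i i' - r₀) 0)) := by
  obtain ⟨a, ha, i', hi', h⟩ := exists_sdist_eq cd (singleton_nonempty i) hb
  rw [mem_singleton.1 ha] at h
  rw [h]
  exact single_le_sum (f := fun i' => Real.exp (-(κ * max (r * cd i i' - r₀) 0))) (fun _ _ => (Real.exp_pos _).le) hi'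

/-- the block distance between blocks is attained: `e^{−c·Dist_cd(b,u)} ≤ Σ_{i∈b} Σ_{i′∈u} e^{−c·cd(i,i′)}` (`b, u ≠ ∅`).
[cite: GlimmJaffeSpencer1973, §8 (8.8) p0234] -/
theorem exp_neg_sdist_le_sum_sum (b u : Finset I) (hb : b.Nonempty) (hu : u.Nonempty) (c : ℝ) :
    Real.exp (-(c * sdist cd b u)) ≤ ∑ i ∈ b, ∑ i' ∈ u, Real.exp (-(c * cd i i')) := by
  obtain ⟨i, hi, i', hi', h⟩ := exists_sdist_eq cd hb hu
  rw [h]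
  refine le_trans ?_ (single_le_sum (f := fun i => ∑ i' ∈ u, Real.exp (-(c * cd i i')))
    (fun _ _ => sum_nonneg fun _ _ => (Real.exp_pos _).le) hi)
  exact single_le_sum (f := fun i' => Real.exp (-(c * cd i i'))) (fun _ _ => (Real.exp_pos _).le) hi'

/-- `e^{−κ·max(r·min(a,a′) − r₀, 0)} ≤ e^{−κ·max(r·a − r₀, 0)} + e^{−κ·max(r·a′ − r₀, 0)}`. [folklore] [cite: GlimmJaffeSpencer1973, §8 (8.2)] -/
theorem exp_neg_max_min_le_add (κ r r₀ a a' : ℝ) :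
    Real.exp (-(κ * max (r * min a a' - r₀) 0)) ≤
      Real.exp (-(κ * max (r * a - r₀) 0)) + Real.exp (-(κ * max (r * a' - r₀) 0)) := by
  rcases le_total a a' with h | h
  · rw [min_eq_left h]; exact le_add_of_nonneg_right (Real.exp_pos _).le
  · rw [min_eq_right h]; exact le_add_of_nonneg_left (Real.exp_pos _).le

/-- **THE CUBE LATTICE SUM AGAINST A BLOCK**: `Σ_{i∈X} e^{−κ·max(r·Dist_cd({i},b) − r₀,0)} ≤ |b|·Z_c` under the cube lattice sum letter
`Σ_{i∈X} e^{−κ·max(r·cd(i,i′) − r₀,0)} ≤ Z_c` (`b ≠ ∅`). [cite: BalabanImbrieJaffe1988, §5.13 p.307 L14–16] -/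
theorem sum_exp_neg_max_sdist_le (X b : Finset I) (hb : b.Nonempty) {κ r r₀ Zc : ℝ}
    (hZc : ∀ i', ∑ i ∈ X, Real.exp (-(κ * max (r * cd i i' - r₀) 0)) ≤ Zc) :
    ∑ i ∈ X, Real.exp (-(κ * max (r * sdist cd {i} b - r₀) 0)) ≤ b.card * Zc :=
  calc ∑ i ∈ X, Real.exp (-(κ * max (r * sdist cd {i} b - r₀) 0))
      ≤ ∑ i ∈ X, ∑ i' ∈ b, Real.exp (-(κ * max (r * cd i i' - r₀) 0)) :=
        sum_le_sum fun i _ => exp_neg_max_sdist_singleton_le_sum cd b hb i κ r r₀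
    _ = ∑ i' ∈ b, ∑ i ∈ X, Real.exp (-(κ * max (r * cd i i' - r₀) 0)) := sum_comm
    _ ≤ ∑ _i' ∈ b, Zc := sum_le_sum fun i' _ => hZc i'
    _ = b.card * Zc := by rw [sum_const, nsmul_eq_mul]

variable [DecidableEq I]

/-- **SLOTS TO CUBES**: with at most `s₀` located slots per cube of `X`, `Σ_{τ∈T} f(cube τ) ≤ s₀·Σ_{i∈X} f(i)` for `f ≥ 0` — the hypothesis `hZs` of
`BIJ88TrainGainAssembly309` from the cube lattice sum. [cite: BalabanImbrieJaffe1988, §5.13 p.307 L14–16, (5.14.4) p.309] -/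
theorem sum_slots_le_mul_sum {Sl : Type*} (T : Finset Sl) (cubeOf : Sl → I) (X : Finset I) (hT : ∀ τ ∈ T, cubeOf τ ∈ X) {s₀ : ℕ}
    (hs₀ : ∀ i ∈ X, (T.filter fun τ => cubeOf τ = i).card ≤ s₀) (f : I → ℝ) (hf : ∀ i ∈ X, 0 ≤ f i) :
    ∑ τ ∈ T, f (cubeOf τ) ≤ s₀ * ∑ i ∈ X, f i := by
  rw [← sum_fiberwise_of_maps_to (g := cubeOf) hT, mul_sum]
  refine sum_le_sum fun i hi => ?_
  rw [sum_congr rfl fun τ hτ => by rw [(mem_filter.1 hτ).2], sum_const, nsmul_eq_mul]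
  exact mul_le_mul_of_nonneg_right (by exact_mod_cast hs₀ i hi) (hf i hi)

/-! ## §4  Disjoint trains: the growth letter of `BIJ88TrainGainAssembly309` -/

/-- **DISJOINT TRAINS NEAR A CUBE ARE FEW**: if the cube sets of the trains are pairwise disjoint subsets of `X` and `δ_k < kk` forces a cube of
train `k` within `cd < kk` of `i₀`, then `#{k : δ_k < kk} ≤ #{i ∈ X : cd(i₀,i) < kk}` — the growth letter `hgr` from the cube growth letter.
[cite: GlimmJaffeSpencer1973, Lemma 10.2 p0242] [cite: BalabanImbrieJaffe1988, §5.13 p.307 L14–18] -/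
theorem card_filter_lt_le_of_disjoint {n : ℕ} (X : Finset I) (cubes : Fin n → Finset I) (hsub : ∀ k, cubes k ⊆ X)
    (hdisj : ∀ k k', k ≠ k' → Disjoint (cubes k) (cubes k')) (δ : Fin n → ℝ) (i₀ : I) {kk : ℝ}
    (hδ : ∀ k, δ k < kk → ∃ i ∈ cubes k, cd i₀ i < kk) :
    (univ.filter fun k => δ k < kk).card ≤ (X.filter fun i => cd i₀ i < kk).card := by
  classical
  have h1 : (univ.filter fun k => δ k < kk).card ≤ ∑ k, ((cubes k).filter fun i => cd i₀ i < kk).card := by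
    rw [card_eq_sum_ones]
    refine (sum_le_sum fun k hk => ?_).trans (sum_le_sum_of_subset_of_nonneg (filter_subset _ _) fun k _ _ => Nat.zero_le _)
    obtain ⟨i, hi, hlt⟩ := hδ k (mem_filter.1 hk).2
    exact card_pos.2 ⟨i, mem_filter.2 ⟨hi, hlt⟩⟩
  have h2 : ∑ k, ((cubes k).filter fun i => cd i₀ i < kk).card =
      (univ.biUnion fun k => (cubes k).filter fun i => cd i₀ i < kk).card := by
    rw [card_biUnion]
    intro k _ k' _ hkk'
    exact disjoint_filter_filter (hdisj k k' hkk')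
  refine h1.trans (h2.le.trans (card_le_card fun i hi => ?_))
  obtain ⟨k, -, hk⟩ := mem_biUnion.1 hi
  exact mem_filter.2 ⟨hsub k (mem_filter.1 hk).1, (mem_filter.1 hk).2⟩

/-! ## §5  Disjoint blocks: the touching degree and the sparseness of `BIJ88TrainCountingBudget307` -/

/-- **THE TOUCHING DEGREE**: for pairwise disjoint blocks `σ` of `X`, if `u` touching `b` forces cubes `i ∈ b`, `i′ ∈ u` with `cd(i,i′) < 2`, then
`#{u ∈ σ : touch b u} ≤ |b|·C₂` under `#{i′ ∈ X : cd(i,i′) < 2} ≤ C₂`. [cite: GlimmJaffeSpencer1973, §8 p0234 («in O(1) ways»)]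
[cite: BalabanImbrieJaffe1988, §5.13 p.307 L16–18] -/
theorem card_filter_touch_le (X : Finset I) (σ : Finset (Finset I)) (hdisj : (σ : Set (Finset I)).PairwiseDisjoint id)
    (hsub : ∀ u ∈ σ, u ⊆ X) (b : Finset I) (touchP : Finset I → Prop) [DecidablePred touchP]
    (htouch : ∀ u ∈ σ, touchP u → ∃ i ∈ b, ∃ i' ∈ u, cd i i' < 2) {C2 : ℕ} (hC2 : ∀ i, (X.filter fun i' => cd i i' < 2).card ≤ C2) :
    (σ.filter touchP).card ≤ b.card * C2 := by
  classical
  have h1 : (σ.filter touchP).card ≤ ∑ u ∈ σ, ∑ i ∈ b, (u.filter fun i' => cd i i' < 2).card := by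
    rw [card_eq_sum_ones]
    refine (sum_le_sum fun u hu => ?_).trans (sum_le_sum_of_subset_of_nonneg (filter_subset _ _) fun u _ _ => Nat.zero_le _)
    obtain ⟨i, hi, i', hi', hlt⟩ := htouch u (mem_filter.1 hu).1 (mem_filter.1 hu).2
    exact le_trans (card_pos.2 ⟨i', mem_filter.2 ⟨hi', hlt⟩⟩)
      (single_le_sum (f := fun i => (u.filter fun i' => cd i i' < 2).card) (fun _ _ => Nat.zero_le _) hi)
  rw [sum_comm] at h1
  refine h1.trans ?_
  have h2 : ∀ i ∈ b, ∑ u ∈ σ, (u.filter fun i' => cd i i' < 2).card ≤ C2 := by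
    intro i _
    have hdisj' : ∀ u ∈ σ, ∀ u' ∈ σ, u ≠ u' →
        Disjoint (u.filter fun i' => cd i i' < 2) (u'.filter fun i' => cd i i' < 2) :=
      fun u hu u' hu' huu' => disjoint_filter_filter (hdisj hu hu' huu')
    rw [← card_biUnion hdisj']
    refine le_trans (card_le_card fun i' hi' => ?_) (hC2 i)
    obtain ⟨u, hu, h⟩ := mem_biUnion.1 hi'
    exact mem_filter.2 ⟨hsub u hu (mem_filter.1 h).1, (mem_filter.1 h).2⟩
  calc ∑ i ∈ b, ∑ u ∈ σ, (u.filter fun i' => cd i i' < 2).card ≤ ∑ _i ∈ b, C2 := sum_le_sum h2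
    _ = b.card * C2 := by rw [sum_const, smul_eq_mul]

/-- **THE SPARSENESS SUM OVER DISJOINT BLOCKS**: `Σ_{u∈σ} e^{−c·Dist_cd(b,u)} ≤ |b|·Z` for pairwise disjoint nonempty blocks `σ` of `X`, `b ≠ ∅`,
under `Σ_{i′∈X} e^{−c·cd(i,i′)} ≤ Z`. [cite: GlimmJaffeSpencer1973, Prop. 8.2 (8.11) p0235] [cite: BalabanImbrieJaffe1988, §5.13 p.307 L14–18] -/
theorem sum_exp_neg_sdist_blocks_le (X : Finset I) (σ : Finset (Finset I)) (hdisj : (σ : Set (Finset I)).PairwiseDisjoint id)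
    (hsub : ∀ u ∈ σ, u ⊆ X) (hne : ∀ u ∈ σ, u.Nonempty) (b : Finset I) (hb : b.Nonempty) {c Z : ℝ}
    (hZ : ∀ i, ∑ i' ∈ X, Real.exp (-(c * cd i i')) ≤ Z) :
    ∑ u ∈ σ, Real.exp (-(c * sdist cd b u)) ≤ b.card * Z := by
  classical
  calc ∑ u ∈ σ, Real.exp (-(c * sdist cd b u)) ≤ ∑ u ∈ σ, ∑ i ∈ b, ∑ i' ∈ u, Real.exp (-(c * cd i i')) :=
        sum_le_sum fun u hu => exp_neg_sdist_le_sum_sum cd b u hb (hne u hu) c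
    _ = ∑ i ∈ b, ∑ u ∈ σ, ∑ i' ∈ u, Real.exp (-(c * cd i i')) := sum_comm
    _ = ∑ i ∈ b, ∑ i' ∈ σ.biUnion id, Real.exp (-(c * cd i i')) := by
        refine sum_congr rfl fun i _ => ?_
        rw [sum_biUnion hdisj]
        rfl
    _ ≤ ∑ i ∈ b, ∑ i' ∈ X, Real.exp (-(c * cd i i')) :=
        sum_le_sum fun i _ => sum_le_sum_of_subset_of_nonneg (fun i' hi' => by
          obtain ⟨u, hu, h⟩ := mem_biUnion.1 hi'; exact hsub u hu h) fun _ _ _ => (Real.exp_pos _).le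
    _ ≤ ∑ _i ∈ b, Z := sum_le_sum fun i _ => hZ i
    _ = b.card * Z := by rw [sum_const, nsmul_eq_mul]

end Cubes

end Literature.MathematicalPhysics.QuantumFieldTheory.BalabanImbrieJaffe1984to88.BIJ88TrainGeometryLetters309
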